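import Summits.NavierStokesRegularity.NavierStokesRegularity.Theorems.AxisymmetricExtremalityAxisymmetricKatoGlobalStubSeregin2020TypeIILemma22ParabolicBumps
import HarnessLib

/-!
# Seregin 2020, Lemma 2.2: the excision schedule for the singular axis set `S` — L22-B, piece F3a

Seat ns-es-p1 g3 (INPUTS A1 / L22-B; cut owner ns-inputs-plan g5, route P refined, kit `A1-L22B-F3.md`).  The energy identity of the
class 𝒱 (`EnergyClass`, N–U 2012 (3.3)/(3.9)) is proved on `S`-free slabs (siblings `…EnergyClassAcrossAxisV3`, `…EnergyClassSFree`); to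
pass across the closed `𝒫¹`-null axis set `S` (Seregin 2020, class 𝒱 (i)) one excises, for fixed test data on `[t₁, t₂] × B̄(0, ρ)`,
finitely many centred parabolic cylinders `Q*_{rᵢ}(zᵢ)` covering `S ∩ ([t₁,t₂] × B̄(0,ρ))` with `∑ rᵢ ≤ ε`, partitions `[t₁, t₂]` by the
endpoints `tᵢ ± 2rᵢ²`, and on each sub-interval cuts out exactly the ACTIVE balls (those whose enlarged time-interval contains it).
This file is the combinatorial schedule:

* `exists_finite_cover_meeting` — the finite cover, every cylinder of which MEETS the covered compact set;
* `exists_sorted_partition` — a finite set of reals pinned at `t₁ ≤ t₂` is enumerated increasingly, no member strictly inside a step;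
* `exists_active_of_mem` — an `S`-point of `]a,b[ × B̄(0,ρ)`, for a step `]a,b[` containing no endpoint, lies in an ACTIVE ball;
  `isOpen_activeDomain`, `not_mem_of_mem_activeSlab` — the open `S`-free slab handed to the slab inequality;
* `sum_activeLength_le` — a ball is active for total time `≤` the length of its enlarged interval (`= 4rᵢ²`);
* `card_activeSwitch_le_two`, `sum_activeSwitch_le` — along the partition each ball enters and leaves the active set at most once each;
* `exists_pos_le_dist_of_notMem`, `le_dist_of_meeting` — a point off `S` is eventually never cut (cylinders meeting `S` near it are far).

WHAT THIS IS NOT: no analysis, no energy inequality, no statement about Navier–Stokes; pure bookkeeping for the `S`-passage (F3c).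
No summit statement is proved here.  [Seregin2020 §3, class 𝒱 (i), arXiv p. 8; NazarovUraltseva2012 §3; CaffarelliKohnNirenberg1982 (2.6)]
-/

-- the problem directory repeats the summit name (D-0017); core's `dupNamespace` linter fires
set_option linter.dupNamespace false

noncomputable section

open MeasureTheory Set Function Filter Topology TopologicalSpace Metric
open scoped NNReal ENNReal

namespace Summit.NavierStokesRegularity.NavierStokesRegularity.Theorems.AxisymmetricKatoGlobal.EulerScaling

open Literature.Analysis.FluidPDE

/-! ### The finite cover -/

/-- **Finite cheap covers by cylinders that meet the set.** For a closed `𝒫¹`-null `S`, a compact `K` and `ε > 0`: finitely many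
centred parabolic cylinders `Q*_{rᵢ}(zᵢ)`, `0 < rᵢ < 1`, `∑ rᵢ ≤ ε`, covering `S ∩ K`, EACH of which meets `S ∩ K`
(`exists_finite_parabolic_cover` on the compact `S ∩ K`, idle cylinders dropped). [cite: CaffarelliKohnNirenberg1982, (2.6)] -/
theorem exists_finite_cover_meeting {S K : Set (ℝ × EuclideanSpace ℝ (Fin 3))} (hS : IsParabolicNull 1 S)
    (hSc : IsClosed S) (hK : IsCompact K) {ε : ℝ} (hε : 0 < ε) :
    ∃ (s : Finset ℕ) (z : ℕ → ℝ × EuclideanSpace ℝ (Fin 3)) (r : ℕ → ℝ),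
      (∀ i ∈ s, 0 < r i ∧ r i < 1) ∧
      S ∩ K ⊆ ⋃ i ∈ s, parabolicCylinderCentered (r i) (z i) ∧
      ∑ i ∈ s, r i ≤ ε ∧
      ∀ i ∈ s, (parabolicCylinderCentered (r i) (z i) ∩ (S ∩ K)).Nonempty := by
  classical
  obtain ⟨s, z, r, hr, hcov, hsum⟩ :=
    exists_finite_parabolic_cover hS (hK.inter_left hSc) inter_subset_left hε
  refine ⟨s.filter (fun i => (parabolicCylinderCentered (r i) (z i) ∩ (S ∩ K)).Nonempty), z, r,
    fun i hi => hr i (Finset.mem_filter.1 hi).1, ?_, ?_, fun i hi => (Finset.mem_filter.1 hi).2⟩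
  · intro w hw
    obtain ⟨i, hi, hiw⟩ := mem_iUnion₂.1 (hcov hw)
    exact mem_iUnion₂.2 ⟨i, Finset.mem_filter.2 ⟨hi, ⟨w, hiw, hw⟩⟩, hiw⟩
  · exact (Finset.sum_le_sum_of_subset_of_nonneg (Finset.filter_subset _ s)
      (fun i hi _ => (hr i hi).1.le)).trans hsum

/-! ### The sorted partition by a finite set of endpoints -/

/-- **Sorted partition.** For a finite set `E` of reals and `t₁ ≤ t₂` there are `p` and an increasing enumeration `τ` with
`τ 0 = t₁`, `τ m = t₂` for `m ≥ p`, `τ m < τ (m+1)` for `m < p`, all values in `[t₁, t₂]`, and NO member of `E` strictly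
inside a step `]τ m, τ (m+1)[`, `m < p` (sort `{t₁, t₂} ∪ (E ∩ ]t₁, t₂[)`). [folklore] -/
theorem exists_sorted_partition (E : Finset ℝ) {t₁ t₂ : ℝ} (h12 : t₁ ≤ t₂) :
    ∃ (p : ℕ) (τ : ℕ → ℝ), Monotone τ ∧ τ 0 = t₁ ∧ (∀ m, p ≤ m → τ m = t₂) ∧ (∀ m < p, τ m < τ (m + 1)) ∧
      (∀ m, t₁ ≤ τ m ∧ τ m ≤ t₂) ∧ ∀ m < p, ∀ e ∈ E, e ∉ Ioo (τ m) (τ (m + 1)) := by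
  classical
  set E' : Finset ℝ := insert t₁ (insert t₂ (E.filter fun e => t₁ < e ∧ e < t₂)) with hE'
  have hk : 0 < E'.card := Finset.card_pos.2 ⟨t₁, Finset.mem_insert_self _ _⟩
  set k := E'.card with hkdef
  set f : Fin k ↪o ℝ := E'.orderEmbOfFin rfl with hf
  -- bounds of `E'`
  have hE'mem : ∀ e ∈ E', t₁ ≤ e ∧ e ≤ t₂ := by
    intro e he
    rcases Finset.mem_insert.1 he with rfl | he
    · exact ⟨le_rfl, h12⟩
    rcases Finset.mem_insert.1 he with rfl | he
    · exact ⟨h12, le_rfl⟩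
    · have := (Finset.mem_filter.1 he).2; exact ⟨this.1.le, this.2.le⟩
  have hne : E'.Nonempty := Finset.card_pos.1 hk
  have hmin : E'.min' hne = t₁ :=
    le_antisymm (Finset.min'_le _ _ (Finset.mem_insert_self _ _))
      (Finset.le_min' _ _ _ fun e he => (hE'mem e he).1)
  have hmax : E'.max' hne = t₂ :=
    le_antisymm (Finset.max'_le _ _ _ fun e he => (hE'mem e he).2)
      (Finset.le_max' _ _ (Finset.mem_insert_of_mem (Finset.mem_insert_self _ _)))
  have hf0 : f ⟨0, hk⟩ = t₁ := by rw [hf, Finset.orderEmbOfFin_zero rfl hk]; exact hmin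
  have hfl : f ⟨k - 1, Nat.sub_lt hk Nat.one_pos⟩ = t₂ := by
    rw [hf, Finset.orderEmbOfFin_last rfl hk]; exact hmax
  have hfmem : ∀ i : Fin k, t₁ ≤ f i ∧ f i ≤ t₂ := fun i => hE'mem _ (Finset.orderEmbOfFin_mem _ _ i)
  -- the enumeration, constant `t₂` after the last index
  let τ : ℕ → ℝ := fun m => if h : m < k then f ⟨m, h⟩ else t₂
  have hτ_of_lt : ∀ m (h : m < k), τ m = f ⟨m, h⟩ := fun m h => dif_pos h
  have hτ_of_le : ∀ m, k ≤ m → τ m = t₂ := fun m h => dif_neg (not_lt.2 h)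
  have hτ_succ : ∀ m, τ m ≤ τ (m + 1) := by
    intro m
    by_cases h1 : m + 1 < k
    · rw [hτ_of_lt m (by omega), hτ_of_lt (m + 1) h1]
      exact (f.strictMono (Fin.mk_lt_mk.2 (Nat.lt_succ_self m))).le
    · rw [hτ_of_le (m + 1) (not_lt.1 h1)]
      by_cases h0 : m < k
      · rw [hτ_of_lt m h0]; exact (hfmem _).2
      · rw [hτ_of_le m (not_lt.1 h0)]
  refine ⟨k - 1, τ, monotone_nat_of_le_succ hτ_succ, ?_, ?_, ?_, ?_, ?_⟩
  · rw [hτ_of_lt 0 hk]; exact hf0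
  · intro m hm
    by_cases h : m < k
    · have hm' : m = k - 1 := by omega
      subst hm'; rw [hτ_of_lt _ h]; exact hfl
    · exact hτ_of_le m (not_lt.1 h)
  · intro m hm
    rw [hτ_of_lt m (by omega), hτ_of_lt (m + 1) (by omega)]
    exact f.strictMono (Fin.mk_lt_mk.2 (Nat.lt_succ_self m))
  · intro m
    by_cases h : m < k
    · rw [hτ_of_lt m h]; exact hfmem _
    · rw [hτ_of_le m (not_lt.1 h)]; exact ⟨h12, le_rfl⟩
  · intro m hm e he hin
    have hmk : m < k := by omega
    have hm1k : m + 1 < k := by omega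
    rw [hτ_of_lt m hmk, hτ_of_lt (m + 1) hm1k] at hin
    -- `e` lies in `E'`, hence is a value of `f`
    have heE' : e ∈ E' := by
      refine Finset.mem_insert_of_mem (Finset.mem_insert_of_mem (Finset.mem_filter.2 ⟨he, ?_, ?_⟩))
      · exact lt_of_le_of_lt (hfmem _).1 hin.1
      · exact lt_of_lt_of_le hin.2 (hfmem _).2
    have heR : e ∈ Set.range f := by rw [hf, Finset.range_orderEmbOfFin]; exact heE'
    obtain ⟨j, hj⟩ := heR
    rw [← hj] at hin
    have h1 : (⟨m, hmk⟩ : Fin k) < j := f.lt_iff_lt.1 hin.1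
    have h2 : j < (⟨m + 1, hm1k⟩ : Fin k) := f.lt_iff_lt.1 hin.2
    rw [Fin.lt_def] at h1 h2
    simp only at h1 h2
    omega

/-! ### Active cylinders on a step of the partition -/

/-- **`S`-points of a step lie in ACTIVE balls.** If the cylinders `Q*_{rᵢ}(zᵢ)`, `i ∈ s`, cover `S ∩ ([t₁,t₂] × B̄(0,ρ))` and the
step `]a, b[ ⊆ [t₁, t₂]` contains no endpoint `tᵢ ± 2rᵢ²`, then every `w ∈ S` with `w.1 ∈ ]a,b[`, `w.2 ∈ B̄(0,ρ)` lies in the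
spatial ball of an active cylinder: `tᵢ - 2rᵢ² ≤ a`, `b ≤ tᵢ + 2rᵢ²`, `dist w.2 xᵢ < rᵢ`. [folklore] -/
theorem exists_active_of_mem {S : Set (ℝ × EuclideanSpace ℝ (Fin 3))} {ρ t₁ t₂ : ℝ} {s : Finset ℕ}
    {z : ℕ → ℝ × EuclideanSpace ℝ (Fin 3)} {r : ℕ → ℝ}
    (hcov : S ∩ (Icc t₁ t₂ ×ˢ closedBall (0 : EuclideanSpace ℝ (Fin 3)) ρ) ⊆ ⋃ i ∈ s, parabolicCylinderCentered (r i) (z i))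
    {a b : ℝ} (ha : t₁ ≤ a) (hb : b ≤ t₂)
    (hpart : ∀ i ∈ s, (z i).1 - 2 * r i ^ 2 ∉ Ioo a b ∧ (z i).1 + 2 * r i ^ 2 ∉ Ioo a b)
    {w : ℝ × EuclideanSpace ℝ (Fin 3)} (hw : w ∈ S) (hwt : w.1 ∈ Ioo a b)
    (hwx : w.2 ∈ closedBall (0 : EuclideanSpace ℝ (Fin 3)) ρ) :
    ∃ i ∈ s, ((z i).1 - 2 * r i ^ 2 ≤ a ∧ b ≤ (z i).1 + 2 * r i ^ 2) ∧ dist w.2 (z i).2 < r i := by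
  have hwK : w ∈ S ∩ (Icc t₁ t₂ ×ˢ closedBall (0 : EuclideanSpace ℝ (Fin 3)) ρ) :=
    ⟨hw, ⟨ha.trans hwt.1.le, hwt.2.le.trans hb⟩, hwx⟩
  obtain ⟨i, hi, hiw⟩ := mem_iUnion₂.1 (hcov hwK)
  rw [mem_parabolicCylinderCentered] at hiw
  have hsq : 0 ≤ r i ^ 2 := sq_nonneg _
  refine ⟨i, hi, ⟨?_, ?_⟩, hiw.2⟩
  · by_contra h
    exact (hpart i hi).1 ⟨lt_of_not_ge h, by linarith [hiw.1.1, hwt.2]⟩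
  · by_contra h
    exact (hpart i hi).2 ⟨by linarith [hiw.1.2, hwt.1], lt_of_not_ge h⟩

/-- **The active domain is open**: `O ∩ {x | ∀ i ∈ s, P i → rᵢ < dist x cᵢ}` for an open `O` and any activity predicate `P`.
[folklore] -/
theorem isOpen_activeDomain (s : Finset ℕ) (P : ℕ → Prop) (c : ℕ → EuclideanSpace ℝ (Fin 3)) (r : ℕ → ℝ)
    {O : Set (EuclideanSpace ℝ (Fin 3))} (hO : IsOpen O) :
    IsOpen (O ∩ {x | ∀ i ∈ s, P i → r i < dist x (c i)}) := by
  have e : {x : EuclideanSpace ℝ (Fin 3) | ∀ i ∈ s, P i → r i < dist x (c i)} =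
      ⋂ i ∈ s, {x | P i → r i < dist x (c i)} := by
    ext x; simp only [mem_setOf_eq, mem_iInter]
  rw [e]
  refine hO.inter (isOpen_biInter_finset fun i _ => ?_)
  by_cases hP : P i
  · simp only [hP, forall_true_left]
    exact isOpen_lt continuous_const (continuous_id.dist continuous_const)
  · simp only [hP, IsEmpty.forall_iff, setOf_true, isOpen_univ]

/-- **The active slab is `S`-free.** Under the hypotheses of `exists_active_of_mem`, no point of `S` lies in
`]a, b[ × (B(0, ρ) ∩ {x | rᵢ < dist x xᵢ for every active i})`. [folklore] -/
theorem not_mem_of_mem_activeSlab {S : Set (ℝ × EuclideanSpace ℝ (Fin 3))} {ρ t₁ t₂ : ℝ} {s : Finset ℕ}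
    {z : ℕ → ℝ × EuclideanSpace ℝ (Fin 3)} {r : ℕ → ℝ}
    (hcov : S ∩ (Icc t₁ t₂ ×ˢ closedBall (0 : EuclideanSpace ℝ (Fin 3)) ρ) ⊆ ⋃ i ∈ s, parabolicCylinderCentered (r i) (z i))
    {a b : ℝ} (ha : t₁ ≤ a) (hb : b ≤ t₂)
    (hpart : ∀ i ∈ s, (z i).1 - 2 * r i ^ 2 ∉ Ioo a b ∧ (z i).1 + 2 * r i ^ 2 ∉ Ioo a b)
    {w : ℝ × EuclideanSpace ℝ (Fin 3)}
    (hw : w ∈ Ioo a b ×ˢ (ball (0 : EuclideanSpace ℝ (Fin 3)) ρ ∩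
      {x | ∀ i ∈ s, ((z i).1 - 2 * r i ^ 2 ≤ a ∧ b ≤ (z i).1 + 2 * r i ^ 2) → r i < dist x (z i).2})) :
    w ∉ S := by
  intro hwS
  obtain ⟨i, hi, hact, hdist⟩ :=
    exists_active_of_mem hcov ha hb hpart hwS hw.1 (ball_subset_closedBall hw.2.1)
  exact lt_irrefl _ ((hw.2.2 i hi hact).trans hdist)

/-! ### Accounting: active time and switching -/

/-- **A ball is active for total time at most the length of its enlarged interval.** For an increasing `τ` and `c ≤ d`, the steps
`[τ m, τ (m+1)]`, `m < p`, with `c ≤ τ m` and `τ (m+1) ≤ d` have total length `≤ d - c`. [folklore] -/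
theorem sum_activeLength_le {τ : ℕ → ℝ} (hτ : Monotone τ) (p : ℕ) {c d : ℝ} (hcd : c ≤ d) :
    ∑ m ∈ (Finset.range p).filter (fun m => c ≤ τ m ∧ τ (m + 1) ≤ d), (τ (m + 1) - τ m) ≤ d - c := by
  classical
  set F := (Finset.range p).filter (fun m => c ≤ τ m ∧ τ (m + 1) ≤ d) with hF
  have hdisj : (F : Set ℕ).PairwiseDisjoint (fun m => Ico (τ m) (τ (m + 1))) := by
    intro m _ m' _ hne
    rcases lt_or_gt_of_ne hne with h | h
    · exact Set.disjoint_left.2 fun x hx hx' => (not_lt.2 ((hτ (Nat.succ_le_of_lt h)).trans hx'.1)) hx.2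
    · exact Set.disjoint_left.2 fun x hx hx' => (not_lt.2 ((hτ (Nat.succ_le_of_lt h)).trans hx.1)) hx'.2
  have hU : (⋃ m ∈ F, Ico (τ m) (τ (m + 1))) ⊆ Icc c d := by
    intro x hx
    obtain ⟨m, hm, hxm⟩ := mem_iUnion₂.1 hx
    have hm' := (Finset.mem_filter.1 hm).2
    exact ⟨hm'.1.trans hxm.1, hxm.2.le.trans hm'.2⟩
  have h1 : volume (⋃ m ∈ F, Ico (τ m) (τ (m + 1))) = ∑ m ∈ F, volume (Ico (τ m) (τ (m + 1))) :=
    measure_biUnion_finset hdisj fun m _ => measurableSet_Ico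
  have h2 : ∑ m ∈ F, volume (Ico (τ m) (τ (m + 1))) ≤ ENNReal.ofReal (d - c) := by
    rw [← h1, ← Real.volume_Icc]; exact measure_mono hU
  simp only [Real.volume_Ico] at h2
  rw [← ENNReal.ofReal_sum_of_nonneg (fun m _ => sub_nonneg.2 (hτ (Nat.le_succ m)))] at h2
  exact (ENNReal.ofReal_le_ofReal_iff (sub_nonneg.2 hcd)).1 h2

/-- **Each ball enters the active set at most once and leaves it at most once**: along an increasing `τ`, the activity
`c ≤ τ m ∧ τ (m+1) ≤ d` changes between consecutive steps for at most two values of `m < p`. [folklore] -/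
theorem card_activeSwitch_le_two {τ : ℕ → ℝ} (hτ : Monotone τ) (p : ℕ) (c d : ℝ) :
    ((Finset.range p).filter (fun m =>
      ¬ ((c ≤ τ m ∧ τ (m + 1) ≤ d) ↔ (c ≤ τ (m + 1) ∧ τ (m + 2) ≤ d)))).card ≤ 2 := by
  classical
  -- a switch is either the entrance (`c` passes) or the exit (`d` passes)
  set A := (Finset.range p).filter (fun m => ¬ c ≤ τ m ∧ c ≤ τ (m + 1)) with hA
  set B := (Finset.range p).filter (fun m => τ (m + 1) ≤ d ∧ ¬ τ (m + 2) ≤ d) with hB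
  have hsub : (Finset.range p).filter (fun m =>
      ¬ ((c ≤ τ m ∧ τ (m + 1) ≤ d) ↔ (c ≤ τ (m + 1) ∧ τ (m + 2) ≤ d))) ⊆ A ∪ B := by
    intro m hm
    rw [Finset.mem_filter] at hm
    rw [Finset.mem_union, hA, hB, Finset.mem_filter, Finset.mem_filter]
    have h01 : τ m ≤ τ (m + 1) := hτ (Nat.le_succ m)
    have h12 : τ (m + 1) ≤ τ (m + 2) := hτ (Nat.le_succ (m + 1))
    by_cases hc : c ≤ τ m
    · -- active status can only be lost through `d`
      right
      refine ⟨hm.1, ?_, ?_⟩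
      · by_contra hd
        exact hm.2 ⟨fun h => absurd h.2 hd, fun h => absurd (h.2.trans' h12) hd⟩
      · intro hd2
        exact hm.2 ⟨fun _ => ⟨hc.trans h01, hd2⟩, fun _ => ⟨hc, h12.trans hd2⟩⟩
    · left
      refine ⟨hm.1, hc, ?_⟩
      by_contra hc1
      exact hm.2 ⟨fun h => absurd h.1 hc, fun h => absurd h.1 hc1⟩
  have hA1 : A.card ≤ 1 := by
    refine Finset.card_le_one.2 fun m hm m' hm' => ?_
    rw [hA, Finset.mem_filter] at hm hm'
    by_contra hne
    rcases lt_or_gt_of_ne hne with h | h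
    · exact hm'.2.1 (hm.2.2.trans (hτ (Nat.succ_le_of_lt h)))
    · exact hm.2.1 (hm'.2.2.trans (hτ (Nat.succ_le_of_lt h)))
  have hB1 : B.card ≤ 1 := by
    refine Finset.card_le_one.2 fun m hm m' hm' => ?_
    rw [hB, Finset.mem_filter] at hm hm'
    by_contra hne
    rcases lt_or_gt_of_ne hne with h | h
    · exact hm.2.2 ((hτ (by omega)).trans hm'.2.1)
    · exact hm'.2.2 ((hτ (by omega)).trans hm.2.1)
  calc _ ≤ (A ∪ B).card := Finset.card_le_card hsub
    _ ≤ A.card + B.card := Finset.card_union_le _ _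
    _ ≤ 2 := by omega

/-- **Switching cost.** Summing nonnegative weights `g i` over the balls that switch at each junction costs at most `2 ∑ g`
(`card_activeSwitch_le_two`, sums exchanged). [folklore] -/
theorem sum_activeSwitch_le {τ : ℕ → ℝ} (hτ : Monotone τ) (p : ℕ) (s : Finset ℕ) (c d : ℕ → ℝ) (g : ℕ → ℝ)
    (hg : ∀ i ∈ s, 0 ≤ g i) :
    ∑ m ∈ Finset.range p, ∑ i ∈ s.filter (fun i =>
        ¬ ((c i ≤ τ m ∧ τ (m + 1) ≤ d i) ↔ (c i ≤ τ (m + 1) ∧ τ (m + 2) ≤ d i))), g i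
      ≤ 2 * ∑ i ∈ s, g i := by
  classical
  simp only [Finset.sum_filter]
  rw [Finset.sum_comm, Finset.mul_sum]
  refine Finset.sum_le_sum fun i hi => ?_
  rw [← Finset.sum_filter, Finset.sum_const, nsmul_eq_mul]
  have := card_activeSwitch_le_two hτ p (c i) (d i)
  calc _ ≤ (2 : ℝ) * g i := by
        exact mul_le_mul_of_nonneg_right (by exact_mod_cast this) (hg i hi)
    _ = 2 * g i := rfl

/-! ### Points off `S` are eventually never cut -/

/-- A point off a closed set is at positive distance from it. [folklore] -/
theorem exists_pos_le_dist_of_notMem {X : Type*} [MetricSpace X] {C : Set X} (hC : IsClosed C) {w₀ : X} (hw₀ : w₀ ∉ C) :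
    ∃ d : ℝ, 0 < d ∧ ∀ w ∈ C, d ≤ dist w₀ w := by
  rcases C.eq_empty_or_nonempty with rfl | hne
  · exact ⟨1, one_pos, fun w hw => hw.elim⟩
  · exact ⟨infDist w₀ C, (hC.notMem_iff_infDist_pos hne).1 hw₀, fun w hw => infDist_le_dist_of_mem hw⟩

/-- **Far points are not cut.** If every point of `C` is at distance `≥ d` from `w₀`, a cylinder `Q*_ϱ(ζ)` with `0 < ϱ < 1`,
`ϱ ≤ ε`, `6ε < d` meets `C`, and `w₀.1` lies in the enlarged time-interval `|w₀.1 - ζ.1| ≤ 2ϱ²`, then `w₀.2` is outside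
`B(ζ.2, 4ϱ)` (where the ball's cut-off lives). [folklore] -/
theorem le_dist_of_meeting {C : Set (ℝ × EuclideanSpace ℝ (Fin 3))} {w₀ : ℝ × EuclideanSpace ℝ (Fin 3)} {d ε ϱ : ℝ}
    {ζ : ℝ × EuclideanSpace ℝ (Fin 3)} (hd : ∀ w ∈ C, d ≤ dist w₀ w) (hϱ1 : ϱ < 1) (hϱε : ϱ ≤ ε)
    (hε : 6 * ε < d) (hmeet : (parabolicCylinderCentered ϱ ζ ∩ C).Nonempty) (ht : |w₀.1 - ζ.1| ≤ 2 * ϱ ^ 2) :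
    4 * ϱ ≤ dist w₀.2 ζ.2 := by
  obtain ⟨w, hwQ, hwC⟩ := hmeet
  rw [mem_parabolicCylinderCentered] at hwQ
  have hϱ0 : 0 < ϱ := lt_of_le_of_lt dist_nonneg hwQ.2
  have hϱsq : ϱ ^ 2 ≤ ϱ := by nlinarith
  have hdw := hd w hwC
  rw [Prod.dist_eq] at hdw
  -- the time components are close, so the space components are far
  have h1 : dist w₀.1 w.1 < d := by
    rw [Real.dist_eq]
    have : |w₀.1 - w.1| ≤ |w₀.1 - ζ.1| + |ζ.1 - w.1| := abs_sub_le _ _ _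
    have h' : |ζ.1 - w.1| < ϱ ^ 2 := abs_sub_lt_iff.2 ⟨by linarith [hwQ.1.2], by linarith [hwQ.1.1]⟩
    linarith
  have h2 : d ≤ dist w₀.2 w.2 := by
    by_contra h
    exact (lt_irrefl d) (lt_of_le_of_lt hdw (max_lt h1 (lt_of_not_ge h)))
  have h3 : dist w₀.2 w.2 ≤ dist w₀.2 ζ.2 + dist w.2 ζ.2 := by
    have := dist_triangle w₀.2 ζ.2 w.2; rw [dist_comm ζ.2 w.2] at this; exact this
  linarith [hwQ.2]

/-! ### Closed steps (the F3c seat's form): membership and an open `S`-free thickened slab -/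

/-- **`S`-points of a CLOSED step lie in active balls** (`exists_active_of_mem` with `w.1 ∈ [a, b]`: the covering cylinder's
enlarged interval reaches `rᵢ² > 0` beyond `w.1`, so it meets the open step and, having no endpoint inside, contains it). [folklore] -/
theorem exists_active_of_mem_Icc {S : Set (ℝ × EuclideanSpace ℝ (Fin 3))} {ρ t₁ t₂ : ℝ} {s : Finset ℕ}
    {z : ℕ → ℝ × EuclideanSpace ℝ (Fin 3)} {r : ℕ → ℝ}
    (hcov : S ∩ (Icc t₁ t₂ ×ˢ closedBall (0 : EuclideanSpace ℝ (Fin 3)) ρ) ⊆ ⋃ i ∈ s, parabolicCylinderCentered (r i) (z i))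
    {a b : ℝ} (ha : t₁ ≤ a) (hb : b ≤ t₂)
    (hpart : ∀ i ∈ s, (z i).1 - 2 * r i ^ 2 ∉ Ioo a b ∧ (z i).1 + 2 * r i ^ 2 ∉ Ioo a b)
    {w : ℝ × EuclideanSpace ℝ (Fin 3)} (hw : w ∈ S) (hwt : w.1 ∈ Icc a b)
    (hwx : w.2 ∈ closedBall (0 : EuclideanSpace ℝ (Fin 3)) ρ) :
    ∃ i ∈ s, ((z i).1 - 2 * r i ^ 2 ≤ a ∧ b ≤ (z i).1 + 2 * r i ^ 2) ∧ dist w.2 (z i).2 < r i := by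
  have hwK : w ∈ S ∩ (Icc t₁ t₂ ×ˢ closedBall (0 : EuclideanSpace ℝ (Fin 3)) ρ) :=
    ⟨hw, ⟨ha.trans hwt.1, hwt.2.trans hb⟩, hwx⟩
  obtain ⟨i, hi, hiw⟩ := mem_iUnion₂.1 (hcov hwK)
  rw [mem_parabolicCylinderCentered] at hiw
  have hsq : 0 ≤ r i ^ 2 := sq_nonneg _
  refine ⟨i, hi, ⟨?_, ?_⟩, hiw.2⟩
  · by_contra h
    exact (hpart i hi).1 ⟨lt_of_not_ge h, by linarith [hiw.1.1, hwt.2]⟩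
  · by_contra h
    exact (hpart i hi).2 ⟨by linarith [hiw.1.2, hwt.1], lt_of_not_ge h⟩

/-- **An open `S`-free slab around an `S`-free compact closed step.** If `S` is closed, `a ≤ b`, `C` is compact and no point of
`S` lies in `[a, b] × C`, then for some `δ > 0` no point of `S` lies in `]a-δ, b+δ[ × C_δ` (`C_δ` the open `δ`-thickening):
the slab handed to the slab inequality with `lo = a - δ`, `hi = b + δ`. [folklore] -/
theorem exists_sFree_thickening {X : Type*} [MetricSpace X] {S : Set (ℝ × X)} (hS : IsClosed S) {a b : ℝ} (hab : a ≤ b)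
    {C : Set X} (hC : IsCompact C) (hSC : ∀ w ∈ S, w.1 ∈ Icc a b → w.2 ∉ C) :
    ∃ δ : ℝ, 0 < δ ∧ ∀ w : ℝ × X, w.1 ∈ Ioo (a - δ) (b + δ) → w.2 ∈ thickening δ C → w ∉ S := by
  have hdisj : Disjoint (Icc a b ×ˢ C) S :=
    Set.disjoint_left.2 fun w hw hwS => hSC w hwS hw.1 hw.2
  obtain ⟨δ, hδ, hδd⟩ := hdisj.exists_thickenings (isCompact_Icc.prod hC) hS
  refine ⟨δ, hδ, fun w hwt hwx hwS => ?_⟩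
  obtain ⟨c, hc, hwc⟩ := Metric.mem_thickening_iff.1 hwx
  -- the nearest point of `[a, b]` to `w.1`
  set t' := max a (min b w.1) with ht'
  have ht'I : t' ∈ Icc a b := ⟨le_max_left _ _, max_le hab (min_le_left _ _)⟩
  have h1 : dist w.1 t' < δ := by
    rw [Real.dist_eq, ht']
    rcases le_total w.1 a with hwa | hwa
    · rw [min_eq_right (hwa.trans hab), max_eq_left hwa, abs_sub_lt_iff]
      constructor <;> linarith [hwt.1]
    · rcases le_total w.1 b with hwb | hwb
      · rw [min_eq_right hwb, max_eq_right hwa, sub_self, abs_zero]; exact hδ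
      · rw [min_eq_left hwb, max_eq_right hab, abs_sub_lt_iff]
        constructor <;> linarith [hwt.2]
  have hmem : w ∈ thickening δ (Icc a b ×ˢ C) :=
    Metric.mem_thickening_iff.2 ⟨(t', c), ⟨ht'I, hc⟩, by rw [Prod.dist_eq]; exact max_lt h1 hwc⟩
  exact Set.disjoint_left.1 hδd hmem (Metric.self_subset_thickening hδ S hwS)

/-- **Global accounting of per-step costs.** Along an increasing `τ`, if step `m` costs `(τ(m+1) - τ m) · ∑_{i active} g i` with
`g ≥ 0`, the total over `m < p` is at most `∑ᵢ (dᵢ - cᵢ) g i` — each ball pays its weight for at most the length of its enlarged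
interval (`sum_activeLength_le`, sums exchanged). [folklore] -/
theorem sum_steps_active_weight_le {τ : ℕ → ℝ} (hτ : Monotone τ) (p : ℕ) (s : Finset ℕ) (c d : ℕ → ℝ)
    (hcd : ∀ i ∈ s, c i ≤ d i) (g : ℕ → ℝ) (hg : ∀ i ∈ s, 0 ≤ g i) :
    ∑ m ∈ Finset.range p, (τ (m + 1) - τ m) * ∑ i ∈ s.filter (fun i => c i ≤ τ m ∧ τ (m + 1) ≤ d i), g i
      ≤ ∑ i ∈ s, (d i - c i) * g i := by
  classical
  simp only [Finset.sum_filter, Finset.mul_sum]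
  rw [Finset.sum_comm]
  refine Finset.sum_le_sum fun i hi => ?_
  have h := sum_activeLength_le hτ p (hcd i hi)
  calc ∑ m ∈ Finset.range p, (τ (m + 1) - τ m) * (if c i ≤ τ m ∧ τ (m + 1) ≤ d i then g i else 0)
      = (∑ m ∈ (Finset.range p).filter (fun m => c i ≤ τ m ∧ τ (m + 1) ≤ d i), (τ (m + 1) - τ m)) * g i := by
        rw [Finset.sum_mul, Finset.sum_filter]
        refine Finset.sum_congr rfl fun m _ => ?_
        split_ifs <;> simp
    _ ≤ (d i - c i) * g i := mul_le_mul_of_nonneg_right h (hg i hi)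

end Summit.NavierStokesRegularity.NavierStokesRegularity.Theorems.AxisymmetricKatoGlobal.EulerScaling

end
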